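import Summits.RiemannHypothesis.RiemannHypothesis.Theorems.WeilColumnPoissonMajorant
import Summits.RiemannHypothesis.RiemannHypothesis.Theorems.WeilColumnBSplineFourier
import Literature.NumberTheory.LFunctions.DeterminantEquationDFITheorem1
import HarnessLib

/-!
# D1 ASSEMBLED: the Poisson majorant `|Θ(u)| ≤ M(u)` of the PART XIX theta series (RH-FREE)

WEIL column (LADDER-RH, W-P(P2); crux `ThetaCertificateSound`, tier-1 programme of director-rh 2026-08-26T00:59Z; this seat's D1
assignment). For the profile `h = profile c₁ m₀ c₂ ε α m` (`WeilColumnBSplineFourier`, p416577) scaled to `G(y) = h(y/λ)`: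
**`‖Σ_{n≥1} h(nu/λ)‖ ≤ (2(1+|α|)/π)·(Σ_{n≥1} n^{−(m+1)})·(m·u/(2πελ))^m`** — THETA-CERT-cc6 §D1's `M(u)` with
`Σ|cᵢ| = 2 + 2α` — from `WeilColumnPoissonMajorant.norm_thetaSum_le_inv_mul_tsum` (p414433), `norm_fourier_profile_le`,
`summable_tsum_norm_le_of_decay`, `integral_profile_eq_zero` (p416577) and the dilation rule. Hypothesis left to the arithmetic
lane: continuity of the B-spline density (base case tent). Nothing here bears on the truth of RH.
-/

set_option linter.dupNamespace false

noncomputable section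

open MeasureTheory Set Filter Complex
open scoped Real FourierTransform
open Literature.NumberTheory.LFunctions

namespace Summit.RiemannHypothesis.RiemannHypothesis.Theorems.WeilColumn.ThetaMellin

/-- **D1 (PART XIX Poisson majorant), assembled.** [this seat; THETA-CERT-cc6 §D1] -/
theorem norm_thetaSum_profile_le {c₁ m₀ c₂ ε α lam : ℝ} {m : ℕ} (hm : 1 ≤ m) (hε : 0 < ε) (h1 : m₀ ≤ c₂ - ε)
    (h2 : c₁ + ε < m₀) (hc₁ : 0 < c₁) (hα : α = (c₂ - ε - m₀) / (m₀ - c₁ - ε)) (hlam : 0 < lam)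
    (hcont : Continuous (profile c₁ m₀ c₂ ε α m)) {u : ℝ} (hu : 0 < u) :
    ‖∑' n : ℕ, profile c₁ m₀ c₂ ε α m ((((n + 1 : ℕ) : ℝ) * u) / lam)‖ ≤
      (2 * (1 + |α|) / π) * (∑' n : ℕ, 1 / ((n : ℝ) + 1) ^ (m + 1)) * (m * u / (2 * π * ε * lam)) ^ m := by
  set h : ℝ → ℂ := profile c₁ m₀ c₂ ε α m with hh
  set G : ℝ → ℂ := fun y => h (lam⁻¹ * y) with hG
  -- hypotheses of the Poisson majorant for G
  have hGc : Continuous G := hcont.comp (continuous_const.mul continuous_id)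
  have hGsupp : HasCompactSupport G := by
    have := (hasCompactSupport_profile (α := α) hm hε.le h1 h2.le).comp_homeomorph (Homeomorph.mulLeft₀ lam⁻¹ (inv_ne_zero hlam.ne'))
    rw [hG, hh]
    exact this
  have hGneg : ∀ y ≤ 0, G y = 0 := fun y hy =>
    profile_eq_zero_of_nonpos hm hε.le h1 h2.le hc₁ (by have := mul_nonpos_of_nonneg_of_nonpos (inv_nonneg.2 hlam.le) hy; simpa [hG] using this)
  -- Fourier transform of G: dilation + the profile bound
  have hFG : ∀ ξ : ℝ, 𝓕 G ξ = (lam : ℂ) * 𝓕 h (ξ * lam) := by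
    intro ξ
    have := fourier_comp_mul h (inv_pos.2 hlam) ξ
    rw [hG, this, div_inv_eq_mul, Complex.ofReal_inv, inv_inv]
  set C : ℝ := (1 + |α|) / π * (m / (2 * π * ε * lam)) ^ m with hC
  have hdecay : ∀ ξ : ℝ, ξ ≠ 0 → ‖𝓕 G ξ‖ ≤ C / |ξ| ^ (m + 1) := by
    intro ξ hξ
    have hξl : ξ * lam ≠ 0 := mul_ne_zero hξ hlam.ne'
    rw [hFG, norm_mul, Complex.norm_real, Real.norm_of_nonneg hlam.le]
    have hb := norm_fourier_profile_le (α := α) hm hε h1 h2.le hξl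
    calc lam * ‖𝓕 h (ξ * lam)‖ ≤ lam * ((1 + |α|) / (π * |ξ * lam|) * (m / (2 * π * ε * |ξ * lam|)) ^ m) :=
          mul_le_mul_of_nonneg_left hb hlam.le
      _ = C / |ξ| ^ (m + 1) := by
          rw [hC, abs_mul, abs_of_pos hlam, div_pow, div_pow, pow_succ]
          have hξ' : |ξ| ≠ 0 := abs_ne_zero.2 hξ
          field_simp
          ring
  have hF0 : 𝓕 G 0 = 0 := by
    rw [Literature.NumberTheory.LFunctions.DFIDeterminant.fourier_zero_eq_integral, hG]
    rw [MeasureTheory.Measure.integral_comp_mul_left (fun y => h y) lam⁻¹]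
    rw [hh, integral_profile_eq_zero h1 h2 hα, smul_zero]
  obtain ⟨hsum, hle⟩ := summable_tsum_norm_le_of_decay (F := 𝓕 G) (p := m) hm hdecay hF0 hu
  have hP := norm_thetaSum_le_inv_mul_tsum hGc hGsupp hGneg hu hsum
  have e : (fun n : ℕ => G (((n + 1 : ℕ) : ℝ) * u)) = fun n : ℕ => h ((((n + 1 : ℕ) : ℝ) * u) / lam) := by
    funext n; simp only [hG]; congr 1; rw [div_eq_inv_mul]
  rw [e] at hP
  refine hP.trans ?_
  have hS : 0 ≤ ∑' n : ℕ, 1 / ((n : ℝ) + 1) ^ (m + 1) := tsum_nonneg fun n => by positivity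
  calc u⁻¹ * ∑' n : ℤ, ‖𝓕 G (n / u)‖ ≤ u⁻¹ * (2 * C * u ^ (m + 1) * ∑' n : ℕ, 1 / ((n : ℝ) + 1) ^ (m + 1)) :=
        mul_le_mul_of_nonneg_left hle (inv_nonneg.2 hu.le)
    _ = (2 * (1 + |α|) / π) * (∑' n : ℕ, 1 / ((n : ℝ) + 1) ^ (m + 1)) * (m * u / (2 * π * ε * lam)) ^ m := by
        rw [hC, div_pow, mul_pow, div_pow, pow_succ]
        field_simp
        ring

end Summit.RiemannHypothesis.RiemannHypothesis.Theorems.WeilColumn.ThetaMellin
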